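import Summits.BirchSwinnertonDyer.BirchSwinnertonDyer.Theorems.ErratumRoadFiveErratumThm23SelfDualDecOfTwoVarCore
import Summits.BirchSwinnertonDyer.BirchSwinnertonDyer.Theorems.ErratumRoadFiveTwoVariableControlFiniteDefect
import Summits.BirchSwinnertonDyer.BirchSwinnertonDyer.Theorems.BiquadraticEisensteinDescentEisensteinHeartFlatCMInertBadKPrimeCharIdealBaseChange
import Literature.NumberTheory.EllipticCurves.PadicCoeffIntegersFrobeniusData
import Summits.BirchSwinnertonDyer.BirchSwinnertonDyer.Theorems.ErratumRoadFiveFixedPartOfThm326SelfDual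
import Summits.BirchSwinnertonDyer.BirchSwinnertonDyer.Theorems.ErratumRoadFiveRamFreeIrrKToIrrQ
import Literature.NumberTheory.EllipticCurves.Castella2018.ErratumThm23UpperDivisibilitySelfDualIrrK
import HarnessLib

/-!
# F4♯‡ — Castella's erratum Thm. 2.3 «⊂» ON THE SELF-DUAL TATE TWIST WITH (i) ∕ (iii) AS PRINTED
# (`Castella2018.erratumThm23_charIdeal_sigma_le_of_isTorsion_selfDual_irrK_OPEN`, p675866) FROM THE PRINT-FAITHFUL
# TWO-VARIABLE CORE S1‡ AND [Wiles 1988 Thm 2.2] ALONE — the ‡ twin of line `erratum_chain`† as ONE kernel-checked theorem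
# (helper, `--supports stmt-BirchSwinnertonDyer-23253`; K6 of `HOME/imc-p1/g26/RAMFREE-REKEY-PROPOSAL.md`, done GO-independently)

Cell `bsd-stepL`, seat `bsd-stepL-imc-p1` (prover g31, 2026-08-29). Theorems only (no definition, no named fact, no `sorry`, no
instance, no notation). The composition of the crux-23253 line `erratum_chain` v3‡
(`ErratumChainSelfDual.erratumThm23SigmaLeSelfDual_of_twoVarCore_of_thm326`, p670957 = p663658 (dec)† + p665011 (¬(dec)†, S2♭♭†) +
p670492 ((FIX)† ⟸ [W])) RE-INSTANTIATED at the PRINTED hypotheses of the erratum's Thm. 2.3 ∕ [FW21, Thm. 4.41]: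

* (i)  «`ρ̄_g|_{G_K}` is irreducible» — `IsSimpleOrder (Subrepresentation ((residualRep Δ).comp (absGaloisRestrict ℚ K)))`;
* (iii) «there is a prime `q ∥ M` non-split in `K`» — `∃ q, q.Prime ∧ q ∣ M ∧ ¬ q² ∣ M ∧ q non-split`;

in place of the footnote-1 SUFFICIENT condition (i′) «`ρ̄_g` irreducible AND ramified at some `q ∥ M` non-split in `K`» that F4♯† ∕ S1†
carry (flag `T23-footnote`; memo `HOME/imc-p1/g26/RAMFREE-ROAD-imc-p1-g26.md`). Statement proved here:

    erratumThm23SigmaLeSelfDualIrrK_OPEN_of_twoVarCoreIrrK_of_thm326 (hFW : ‹S1‡›) (hW : Hida2000_thm326_ordinary_unitRoot) :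
      Castella2018.erratumThm23_charIdeal_sigma_le_of_isTorsion_selfDual_irrK_OPEN

with S1‡ := S1† (`Cruxes/ErratumThm23SigmaLeSelfDual/Lines/erratum_chain.lean` v3‡ l.69–112, = binder `hFW` of p670957) with EXACTLY
its (i′) block (five lines) replaced by the two printed binders above, every other character identical (REKEY-PROPOSAL §1: «S1‡ :=
S1† with exactly that block replaced … Both are the SAME open mathematics ([FW21 Thm 4.41] at the twist + App. B + wt-k CGS +
[Hsi14 B]): print states it under (i)∕(iii), i.e. S1‡ is the print-faithful stub and S1† its (ram)-specialisation»).

## Why no FixFinal‡ ∕ LocalDefect‡ re-instantiation is needed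

In the landed † chain the (i′) binders are CONSUMED at exactly two places: (glob)† `SelfDualTwist.noFixedTorsion_selfDual_of_
isResiduallyIrreducible'` (wants `IsResiduallyIrreducible Δ` only) and the call of S1† itself. Everything else — (unr)†, [SU14 L.3.1.9],
exact ∕ finite-defect control (`ControlAt.*`, `ControlFiniteDefect.*`), the descent [JSW17 Cor. 3.4.2] (`TwoVariableDescent.*`), and the
S2♭♭† input — is generic in the representation; in particular the S2♭♭† wrapper `LocalDefectAtSelfDual.stub_localDefectFiniteAnomalous_
selfDual_of_inputs` introduces the (i′) binders as `_h16 _h17` (unused), its content being the binder-free inner theorems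
`LocalDefectAtSelfDual.finite_localDefect_of_open_of_finN` ∘ `LocalDefectAtData.openDecompositionAtPbar` (Rubin) ∘
`LocalDefectAtSelfDual.finN_selfDual_of_finiteFixed` ∘ `FixFinalSelfDual.finiteFixedPartAnomalous_selfDual_of_thm326 hW`. So the ‡
chain is: `IsResiduallyIrreducible Δ` from (i) by `RamFree.isResiduallyIrreducible_of_irrK` (p676255: irreducible after restriction ⟹
irreducible), then the † proof bodies of p663658 ((dec)†: exact control) and p665011 (¬(dec)†: finite-defect control, the local defect
finite by the four inner theorems just named), with S1‡ fed the printed (i)∕(iii). ONE theorem, two cases.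

## What it is for

With imc-p1 g30's consumer (`RekeyIrrK.multiplicativeRankOne_of_thm23SelfDualIrrK_OPEN_of_items`, p688533: K2a's `closes` with
`h23 : F4♯‡`) this makes «S1‡ + [W] + the other route items ⟹ `X11b.MultiplicativeRankOne`» a tree theorem (sequel file
`ErratumRoadFiveClosesOfFW21IrrK.lean`): the OPEN input of rung K2a on the (ram) road is then displayed in its PRINT-FAITHFUL form
([FW21, Thm. 4.41] bullets 1–3 + App. B Cor. 7.21 ∕ L. 7.22 + the weight-`k` pin + [Hsi14, Thm. B]) rather than through its
(ram)-specialisation S1†; and on the planner's RAMFREE re-key (RULING 86 (c), twin crux `ErratumThm23SigmaLeSelfDualIrrK := F4♯‡`)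
the twin line's `_of` IS this theorem (turnkey `HOME/imc-p1/g31/erratum_chain_irrK-v1-proposed.lean`), zero further kernel work.
DIRECTION OF STRENGTH: S1‡ has weaker hypotheses than S1†, so it is the (slightly) STRONGER open claim — exactly the printed one;
S1‡ ⟹ S1† would need [Ski20, L. 2.8.1] (Carayol unipotence at `q ∥ M`, no tree predicate) and is not claimed.

HONEST FRAMING: CONDITIONAL on S1‡ (OPEN ∕ PRE: unrefereed [FW21] + the unprinted weight-`k` CGS computation) and on the named fact
[W] (`Hida2000_thm326_ordinary_unitRoot`, route item 23081); the conclusion is itself an OPEN claim-tagged `Prop` (F4♯‡), derived here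
only under those two displayed hypotheses; no crux, no route item and no summit statement is closed; the anticyclotomic main
conjecture is asserted nowhere; BSD is proved for no pair; closes: none (T7).

[claim: FouquetWan2021, Thm. 4.41, App. B Cor. 7.21, Lemma 7.22, status: under-review] [claim: Castella2018Erratum, Thm. 2.3, status: under-review]
[cite: JetchevSkinnerWan2017, §3.4, Lemma 3.4.1, Cor. 3.4.2 (arXiv:1512.06894 p. 14)] [cite: Castella2018Erratum, §2 (p. 2), Lemma 2.1, Thm. 2.3 (i)–(iv) (p. 3), footnote 1 (p. 4)]
[cite: Wiles1988, Thm. 2.2] [cite: Rubin1991, §5 pp. 38–39] [cite: NeukirchSchmidtWingberg2008, Ch. V §1, (5.1.4) Remark 4]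
-/

noncomputable section

-- D-0017: single-problem summit, the namespace repeats the problem name by design.
set_option linter.dupNamespace false
set_option autoImplicit false

open scoped Classical

open PowerSeries NumberField IsDedekindDomain Field
  Literature.NumberTheory.EllipticCurves Literature.NumberTheory.EllipticCurves.ModularForms
  Literature.NumberTheory.EllipticCurves.BigGaloisRep Literature.NumberTheory.EllipticCurves.GreenbergSelmer
  Literature.NumberTheory.GaloisRepresentations

namespace Summit.BirchSwinnertonDyer.BirchSwinnertonDyer.Theorems.ErratumThm23TwoVariable.ErratumChainSelfDualIrrK

set_option maxHeartbeats 800000 in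
-- statement-sized packages over the iterated big representation (as p663658 ∕ p665011); the proof is glue
/-- **F4♯‡ ⟸ S1‡ + [Wiles 1988 Thm 2.2].** `hFW` = S1‡, the print-faithful two-variable core: [FW21, Thm. 4.41] Σ-imprimitive at the
self-dual twist + App. B Cor. 7.21 ∕ L. 7.22 + the weight-`k` CGS restriction + [Hsi14, Thm. B], pinned on `T_c = 0`, under (i) «`ρ̄_g|_{G_K}`
irreducible» and (iii) «∃ `q ∥ M` non-split in `K`» AS PRINTED (= S1† of line `erratum_chain` v3‡ with exactly its (i′) block replaced);
`hW` = the named fact `Hida2000_thm326_ordinary_unitRoot` ([Wiles88 Thm. 2.2 ∕ Hida00 Thm. 3.26 (2)], route item 23081); conclusion = F4♯‡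
`Castella2018.erratumThm23_charIdeal_sigma_le_of_isTorsion_selfDual_irrK_OPEN` BY NAME. Proof: (irred_ℚ) from (i)
(`RamFree.isResiduallyIrreducible_of_irrK`), hence (glob)†; then on (dec)† exact control (body of p663658), on ¬(dec)† finite-defect control
with the local defect finite by `finite_localDefect_of_open_of_finN ∘ openDecompositionAtPbar ∘ finN_selfDual_of_finiteFixed ∘
finiteFixedPartAnomalous_selfDual_of_thm326 hW` (body of p665011); in both cases the S1‡-fed descent [JSW17, Cor. 3.4.2].
[cite: Castella2018Erratum, proof of Thm. 2.3: (2.4) ⇒ (2.5) (p. 4); Thm. 2.3 (i), (iii) (p. 3)]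
[cite: JetchevSkinnerWan2017, §3.4, Lemma 3.4.1, Cor. 3.4.2 (arXiv:1512.06894 p. 14)] [cite: Wiles1988, Thm. 2.2] -/
theorem erratumThm23SigmaLeSelfDualIrrK_OPEN_of_twoVarCoreIrrK_of_thm326
    (hFW :
    ∀ {p : ℕ} [Fact p.Prime] (ι : PadicAlgCl p ≃+* ℂ) {M : ℕ} [NeZero M] {k : ℤ}
      (g : CuspForm (CongruenceSubgroup.Gamma0 M) k) (ιg : coeffField g →+* PadicAlgCl p)
      (Δ : OrdinaryNewformDatum g p ιg)
      (K : Type) [Field K] [NumberField K] (𝔭 𝔭bar : HeightOneSpectrum (𝓞 K)) (κ : ZpExtension K p)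
      (γ : absoluteGaloisGroup K) [Fact (κ.IsTopGenerator γ)] (S : Finset (HeightOneSpectrum (𝓞 K))),
      IsNewform0 g → 2 ≤ k → Even k → 3 ≤ M → ¬ p ∣ M → 3 < p →
      (∀ x : coeffField g, ι (ιg x) = (x : ℂ)) →
      ‖ιg ⟨(UpperHalfPlane.qExpansion 1 ⇑g).coeff p, coeff_mem_coeffField g p⟩‖ = 1 →
      IsImaginaryQuadratic K → (∃ β : ℤ, (4 * M : ℤ) ∣ β ^ 2 - NumberField.discr K) →
      ((Ideal.span {(p : ℤ)}).primesOver (𝓞 K)).ncard = 2 →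
      ((p : ℕ) : 𝓞 K) ∈ 𝔭.asIdeal →
      (∀ (w : InfinitePlace K) (x : 𝓞 K), x ∈ 𝔭.asIdeal ↔ ‖ι.symm (w.embedding (x : K))‖ < 1) →
      ((p : ℕ) : 𝓞 K) ∈ 𝔭bar.asIdeal → 𝔭bar ≠ 𝔭 →
      -- (i) AS PRINTED: `ρ̄_g|_{G_K}` irreducible (erratum Thm. 2.3 (i); [FW21, Thm. 4.41] first bullet)
      IsSimpleOrder (Subrepresentation
        ((SkinnerUrban2014.residualRep Δ).comp (absGaloisRestrict ℚ K : absoluteGaloisGroup K →* absoluteGaloisGroup ℚ))) →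
      -- (iii) AS PRINTED: some prime `q ∥ M` is non-split in `K` (erratum Thm. 2.3 (iii); [FW21, Thm. 4.41] third bullet)
      (∃ q : ℕ, q.Prime ∧ q ∣ M ∧ ¬ q ^ 2 ∣ M ∧ ((Ideal.span {(q : ℤ)}).primesOver (𝓞 K)).ncard ≠ 2) →
      (((Ideal.span {(2 : ℤ)}).primesOver (𝓞 K)).ncard ≠ 2 → (2 ∣ M ∧ ¬ 4 ∣ M)) →
      (∀ ℓ : ℕ, ℓ.Prime → ℓ ∣ M → ((Ideal.span {(ℓ : ℤ)}).primesOver (𝓞 K)).ncard ≠ 2 →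
        ¬ ℓ ^ 2 ∣ M ∧ (UpperHalfPlane.qExpansion 1 ⇑g).coeff ℓ = -((ℓ : ℂ) ^ (k / 2 - 1).toNat)) →
      κ.IsAnticyclotomic → (∀ w ∈ S, ((p : ℕ) : 𝓞 K) ∉ w.asIdeal) →
      (∀ w : HeightOneSpectrum (𝓞 K), ((M : ℕ) : 𝓞 K) ∈ w.asIdeal → w ∈ S) →
      ∀ (b : padicCoeffIntegers ιg →+* PadicComplexInt p),
        (∀ x, ((b x : PadicComplexInt p) : ℂ_[p]) =
          algebraMap (PadicAlgCl p) ℂ_[p] (padicCoeffIntegers.toPadicAlgCl ιg x)) →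
      ∀ (ΩK : ℂ) (Ωp : (PadicComplexInt p)ˣ) (Q : PowerSeries (PadicComplexInt p)), ΩK ≠ 0 →
        IsBDPLFunctionWtSigmaInt ι 𝔭 κ γ g S ΩK ((Ωp : PadicComplexInt p) : ℂ_[p]) Q →
      -- the complementary (cyclotomic) direction `κ'` with generator `γ'`: `Γ_K = Γ⁺ ⊕ Γ⁻ ≅ ℤ_p²` for `p` odd
      ∀ (κ' : ZpExtension K p) (γ' : absoluteGaloisGroup K) [Fact (κ'.IsTopGenerator γ')], κ'.IsCyclotomic →
      ∀ [TopologicalSpace (PowerSeries (padicCoeffIntegers ιg))]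
        [TopologicalSpace (PowerSeries (PowerSeries (padicCoeffIntegers ιg)))]
        [ContinuousSMul (PowerSeries (PowerSeries (padicCoeffIntegers ιg)))
          (BigRepModule (PowerSeries (padicCoeffIntegers ιg)) p
            (BigRepModule (padicCoeffIntegers ιg) p (Cofree Δ.selfDualRep (padicCoeffField ιg))))],
      -- premise: `X^Σ_K(A_g)` is `Λ_K`-torsion; conclusion: a two-variable frame pinned to `Q` on `X = 0` dividing `Ch_{Λ_K}(X^Σ_K(A_g))`
      Module.IsTorsion (PowerSeries (PowerSeries (padicCoeffIntegers ιg)))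
          (XBig κ' (AnticyclotomicBigGaloisRep κ (Δ.selfDualCofreeRepOver K)) 𝔭bar (↑S)) →
      ∃ Q₂ : PowerSeries (PowerSeries (PadicComplexInt p)),
        (∃ u : (PowerSeries (PadicComplexInt p))ˣ,
            PowerSeries.constantCoeff Q₂ = (u : PowerSeries (PadicComplexInt p)) * Q) ∧
        (XBig.charIdeal κ' (AnticyclotomicBigGaloisRep κ (Δ.selfDualCofreeRepOver K)) 𝔭bar (↑S)).map
            (PowerSeries.map (PowerSeries.map b)) ≤ Ideal.span {Q₂} )
    (hW : Literature.NumberTheory.EllipticCurves.Hida2000_thm326_ordinary_unitRoot) :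
    Literature.NumberTheory.EllipticCurves.Castella2018.erratumThm23_charIdeal_sigma_le_of_isTorsion_selfDual_irrK_OPEN := by
  intro p _ ι M _ k g ιg Δ K _ _ 𝔭 𝔭bar κ γ _ S h1 h2 h3 h4 h5 h6 h7 h8 h9 h10 h11 h12 h13 h14 h15 h16 h17
    h18 h19 h20 h21 h22 b h23 ΩK Ωp Q h24 h25 _i1 _i2 h26
  -- (irred_ℚ) from the printed (i) «`ρ̄_g|_{G_K}` irreducible» (irreducible after restriction ⟹ irreducible)
  have h16' : SkinnerUrban2014.IsResiduallyIrreducible Δ := RamFree.isResiduallyIrreducible_of_irrK Δ K h16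
  -- (glob)† from irreducibility (tree theorem)
  have hglob := SelfDualTwist.noFixedTorsion_selfDual_of_isResiduallyIrreducible' Δ K h6 h9 h16'
  -- a cyclotomic `ℤ_p`-extension with a topological generator; any topology on `Λ_K` (the conclusion does not see it)
  obtain ⟨κ', hκ'⟩ := Literature.NumberTheory.EllipticCurves.exists_cyclotomicZpExtension_holds K p
  obtain ⟨γ', hγ'⟩ := κ'.surjective (Multiplicative.ofAdd 1)
  haveI : Fact (κ'.IsTopGenerator γ') := ⟨hγ'⟩
  letI : TopologicalSpace (PowerSeries (PowerSeries (padicCoeffIntegers ιg))) := ⊥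
  haveI : DiscreteTopology (PowerSeries (PowerSeries (padicCoeffIntegers ιg))) := ⟨rfl⟩
  -- (unr)† and the one-variable finite generation, from the tree
  have hSM' : ∀ w : HeightOneSpectrum (𝓞 K), w ∉ (↑S : Set (HeightOneSpectrum (𝓞 K))) →
      ((M : ℕ) : 𝓞 K) ∉ w.asIdeal := fun w hw hM ↦ hw (Finset.mem_coe.2 (h22 w hM))
  have hunr := SelfDualTwist.selfDualCofreeRepOver_localMap_inr_apply_eq_self Δ K (↑S) hSM'
  haveI := CoeffRing.finiteDimensional_padicCoeffField ιg h1
  haveI : Module.Finite (PowerSeries (padicCoeffIntegers ιg)) (XBig κ (Δ.selfDualCofreeRepOver K) 𝔭bar (↑S)) :=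
    SkinnerUrban2014.moduleFinite_XBig κ 𝔭bar (↑S) S.finite_toSet (Δ.selfDualCofreeRepOver K)
      (GreenbergSelmer.Cofree.exists_pow_psmul_eq_zero ιg Δ.selfDualRep)
      (GreenbergSelmer.Cofree.divisible (padicCoeffField ιg) Δ.selfDualRep (Fact.out : p.Prime).ne_zero)
      (GreenbergSelmer.Cofree.finite_setOf_psmul_eq_zero ιg Δ.selfDualRep) hunr
  -- ring-theoretic clauses for the newform's coefficient ring
  haveI : IsPrincipalIdealRing (padicCoeffIntegers ιg) := CoeffRing.isPrincipalIdealRing ιg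
  haveI : UniqueFactorizationMonoid (PowerSeries (PowerSeries (padicCoeffIntegers ιg))) :=
    CoeffRing.uniqueFactorizationMonoid_powerSeries_powerSeries ιg
  by_cases hdec : ∀ a : Cofree Δ.selfDualRep (padicCoeffField ιg),
      (∀ σ : LocalGroup K (Sum.inl 𝔭bar), (Δ.selfDualCofreeRepOver K) (localMap K (Sum.inl 𝔭bar) σ) a = a) →
      (∃ j : ℕ, p ^ j • a = 0) → a = 0
  · /- (dec)†: EXACT control (body of p663658) -/
    haveI := ControlAt.module_finite_XBig_iterate κ κ' (Δ.selfDualCofreeRepOver K) 𝔭bar (↑S) hglob hdec hunr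
    -- the EXACT control map (kernel zero, hence pseudo-null), packaged with `Exists.choose`
    have key := ControlAt.exists_controlMap κ κ' (Δ.selfDualCofreeRepOver K) 𝔭bar (↑S) hglob hdec hunr
    -- two-variable torsion from the one-variable torsion premise + control (determinant trick)
    have hs := TwoVariableDescent.exists_constantCoeff_ne_zero_of_control
      (A := PowerSeries (padicCoeffIntegers ιg))
      (XBig κ' (AnticyclotomicBigGaloisRep κ (Δ.selfDualCofreeRepOver K)) 𝔭bar (↑S))
      (XBig κ (Δ.selfDualCofreeRepOver K) 𝔭bar (↑S)) h26 key.choose key.choose_spec.2.2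
    have htors₂ := TwoVariableDescent.isTorsion_of_exists_constantCoeff_ne_zero
      (A := PowerSeries (padicCoeffIntegers ιg))
      (XBig κ' (AnticyclotomicBigGaloisRep κ (Δ.selfDualCofreeRepOver K)) 𝔭bar (↑S)) hs
    -- the two-variable core (S1‡), for this cyclotomic `κ'`, under the PRINTED (i) ∕ (iii)
    obtain ⟨Q₂, ⟨u, hu⟩, hle⟩ := hFW ι g ιg Δ K 𝔭 𝔭bar κ γ S h1 h2 h3 h4 h5 h6 h7 h8 h9 h10 h11 h12 h13
      h14 h15 h16 h17 h18 h19 h20 h21 h22 b h23 ΩK Ωp Q h24 h25 κ' γ' hκ' htors₂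
    -- descent of the characteristic ideal along `T_c ↦ 0` (JSW Cor. 3.4.2, kernel form), read in `𝓞_{ℂ_p}`
    have hdesc := TwoVariableDescent.charIdeal_le_map_constantCoeff_of_control
      (A := PowerSeries (padicCoeffIntegers ιg))
      (XBig κ' (AnticyclotomicBigGaloisRep κ (Δ.selfDualCofreeRepOver K)) 𝔭bar (↑S))
      (XBig κ (Δ.selfDualCofreeRepOver K) 𝔭bar (↑S)) h26 key.choose key.choose_spec.1 key.choose_spec.2.2
    refine (Ideal.map_mono hdesc).trans ?_
    rw [TwoVariableDescent.map_map_constantCoeff_eq b]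
    exact TwoVariableDescent.map_constantCoeff_le_span_of_le_span_of_eq_unit_mul hle hu
  · /- ¬(dec)†: FINITE-DEFECT control (body of p665011), the local defect finite by the binder-free inner theorems of
       `LocalDefectAtSelfDual` ∕ `LocalDefectAtData` ∕ `FixFinalSelfDual` ((FIX)† ⟸ [W]) -/
    have hfin : Finite (QuotSMulTop (PowerSeries.X : PowerSeries (PowerSeries (padicCoeffIntegers ιg)))
        ↥((((AnticyclotomicBigGaloisRep κ' (AnticyclotomicBigGaloisRep κ (Δ.selfDualCofreeRepOver K))).restrict
          (localMap K (Sum.inl 𝔭bar))).toTopRep).ρ.invariants)) :=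
      LocalDefectAtSelfDual.finite_localDefect_of_open_of_finN Δ K 𝔭bar κ κ'
        (LocalDefectAtData.openDecompositionAtPbar K 𝔭bar κ κ' h6 h9 h11 h14 h20 hκ')
        (LocalDefectAtSelfDual.finN_selfDual_of_finiteFixed
          (FixFinalSelfDual.finiteFixedPartAnomalous_selfDual_of_thm326 hW)
          g ιg Δ K 𝔭bar κ κ' h1 h2 h3 h5 h6 h8 h9 h11 h14 h20 hκ')
    haveI := ControlFiniteDefect.module_finite_XBig_iterate_of_finite_defect κ κ' (Δ.selfDualCofreeRepOver K) 𝔭bar (↑S)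
      hglob hunr hfin
    have key := ControlFiniteDefect.exists_controlMap_of_finite_defect κ κ' (Δ.selfDualCofreeRepOver K) 𝔭bar (↑S)
      hglob hunr hfin
    -- its finite kernel is pseudo-null over `Λ_𝒪`
    letI : _root_.Module (PowerSeries (padicCoeffIntegers ιg))
        (QuotSMulTop (PowerSeries.X : PowerSeries (PowerSeries (padicCoeffIntegers ιg)))
          (XBig κ' (AnticyclotomicBigGaloisRep κ (Δ.selfDualCofreeRepOver K)) 𝔭bar (↑S))) :=
      Module.compHom _ (PowerSeries.C (R := PowerSeries (padicCoeffIntegers ιg)))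
    haveI : Finite (LinearMap.ker key.choose) := key.choose_spec.2
    -- (`𝒪 = padicCoeffIntegers ι_g` is a DVR, transported from the unit ball of the finite extension `ℚ_p(ι_g K_g)`;
    -- a finite `Λ_𝒪`-module is pseudo-null)
    haveI : IsDiscreteValuationRing (padicCoeffIntegers ιg) := by
      haveI := CoeffRing.isDiscreteValuationRing_unitBall (p := p) (padicCoeffField ιg)
      obtain ⟨e, -, -⟩ := GreenbergSelmer.exists_ringEquiv_unitBall ιg
      exact IsDiscreteValuationRing.RingEquivClass.isDiscreteValuationRing e.symm
    have hpn : Literature.NumberTheory.EllipticCurves.Module.IsPseudoNull (PowerSeries (padicCoeffIntegers ιg))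
        (LinearMap.ker key.choose) :=
      BiquadraticEisensteinDescentEisensteinHeartFlatCMInertBadKPrimeCharIdealBaseChange.isPseudoNull_of_finite
    -- two-variable torsion from the one-variable torsion premise + control (determinant trick)
    have hs := TwoVariableDescent.exists_constantCoeff_ne_zero_of_control
      (A := PowerSeries (padicCoeffIntegers ιg))
      (XBig κ' (AnticyclotomicBigGaloisRep κ (Δ.selfDualCofreeRepOver K)) 𝔭bar (↑S))
      (XBig κ (Δ.selfDualCofreeRepOver K) 𝔭bar (↑S)) h26 key.choose hpn
    have htors₂ := TwoVariableDescent.isTorsion_of_exists_constantCoeff_ne_zero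
      (A := PowerSeries (padicCoeffIntegers ιg))
      (XBig κ' (AnticyclotomicBigGaloisRep κ (Δ.selfDualCofreeRepOver K)) 𝔭bar (↑S)) hs
    -- the two-variable core (S1‡), for this cyclotomic `κ'`, under the PRINTED (i) ∕ (iii)
    obtain ⟨Q₂, ⟨u, hu⟩, hle⟩ := hFW ι g ιg Δ K 𝔭 𝔭bar κ γ S h1 h2 h3 h4 h5 h6 h7 h8 h9 h10 h11 h12 h13
      h14 h15 h16 h17 h18 h19 h20 h21 h22 b h23 ΩK Ωp Q h24 h25 κ' γ' hκ' htors₂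
    -- descent of the characteristic ideal along `T_c ↦ 0` with PSEUDO-NULL kernel (JSW Cor. 3.4.2, kernel form)
    have hdesc := TwoVariableDescent.charIdeal_le_map_constantCoeff_of_control
      (A := PowerSeries (padicCoeffIntegers ιg))
      (XBig κ' (AnticyclotomicBigGaloisRep κ (Δ.selfDualCofreeRepOver K)) 𝔭bar (↑S))
      (XBig κ (Δ.selfDualCofreeRepOver K) 𝔭bar (↑S)) h26 key.choose key.choose_spec.1 hpn
    refine (Ideal.map_mono hdesc).trans ?_
    rw [TwoVariableDescent.map_map_constantCoeff_eq b]
    exact TwoVariableDescent.map_constantCoeff_le_span_of_le_span_of_eq_unit_mul hle hu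

end Summit.BirchSwinnertonDyer.BirchSwinnertonDyer.Theorems.ErratumThm23TwoVariable.ErratumChainSelfDualIrrK

end
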